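import Summits.ResolutionOfSingularities.ResolutionOfSingularities.Theorems.PurelyInseparableDim4ChartChainHistoryEscape
import Summits.ResolutionOfSingularities.ResolutionOfSingularities.Theorems.PurelyInseparableDim4ChartBoundary
import Summits.ResolutionOfSingularities.ResolutionOfSingularities.Theorems.PurelyInseparableDim4EquimultiplePoints
import HarnessLib

/-!
# Purely inseparable four-folds `z^p + F(x₁, …, x₄)`: GROUPING — when two re-centred chart-centres of a blow-up of
# `𝔸⁵` along `V(z, x_S)` are disjoint (brick (c) «GROUPING», model side, of cell `res-dim4-pi`; typ-2 g3 for
# typ-3 g3's joint point∘coordinate tree v2)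

[OURS · counted 0] (D-0157 DOOR 2; director-resolution DR-157-C; desk WORD #66 (4)(c) / #70 (c); asked BY SIGNATURE
by typ-3 g3, bus 22:42:25Z). After blowing up a coordinate member, the order-`p` points over it must be PACKAGED into
finitely many pairwise-disjoint new members; on the MODEL — `π : W → 𝔸⁵_K` any blowing up along `V(z, x_S)` — a
candidate new member is a CHART-CENTRE `T(j, b, S'') := φ_{j,b}(V(z, x_{S''}))`, the image of a coordinate subspace
under a re-centred chart `φ_{j,b} = Spec Θ_b ≫ chartImm_j` (`j ∈ S`, `Θ_b xᵢ = xᵢ + bᵢ`, `b_j = 0`, constants fixed,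
the cleaning of `z` arbitrary). PROVED here (no `sorry`, no new axiom), as criteria on the data `(j, b, S'')`:

* `X_sub_C_mem_of_specMap_mem_CΛ` — a point of `Spec Θ_b (V(x_{Λ''}))` contains `xᵢ − bᵢ` for every `xᵢ ∈ Λ''`;
* **`disjoint_image_CΛ_recenter_of_ne`** / **`disjoint_image_CΛ_chart_of_ne`** — SAME CHART, SEPARATED ⇒ DISJOINT:
  if some `i ∈ S'' ∩ S'''` has `bᵢ ≠ b'ᵢ` then `T(j, b, S'') ∩ T(j, b', S''') = ∅` (as sets of scheme points: a common
  point would contain `xᵢ − bᵢ` and `xᵢ − b'ᵢ`, hence the unit `bᵢ − b'ᵢ`; no order-`p` input, any cleanings);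
* **`disjoint_image_CΛ_chart_range_of_eq_zero`** / **`disjoint_image_CΛ_chart_of_ne_chart`** — ACROSS CHARTS
  `j ≠ j'`: if the point `b'` of the `x_{j'}`-chart lies on the strict transform of the old hyperplane `x_j = 0`
  (`b'_j = 0`) and `x_j` is a variable of the centre (`j ∈ S'''`, automatic for `S.erase j' ⊆ S'''`), then
  `T(j', b', S''')` misses the WHOLE `x_j`-chart (the strict transform of `V(x_j)` is empty on the `x_j`-chart,
  `strictTransformIdeal_hyperplane_self_comap_chartImm`, and reads `V(x_j)` on the `x_{j'}`-chart), hence every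
  `T(j, b, S'')`.

What is NOT here: the converse «agreement on `S'' ∩ S'''` ⇒ the centres meet» (true for PERMISSIBLE centres, where
the `z`-coordinates are the unique `p`-th roots) and the cross-chart case `b'_j ≠ 0` (there `T(j', b', S''')` is
itself an `x_j`-chart centre after transposing `j ↔ j'`; needs the chart-to-chart transition of `AffineCoordBlowup`,
not in the tree as a lemma). Nothing here is a statement about resolution of singularities in dimension ≥ 4 /
characteristic `p` (NOT proved anywhere in this programme). bears_on: LADDER-RESOLUTION:D157-DOOR2 (res-dim4-pi).
Supports stmt-ResolutionOfSingularities-16155 (helper, (c) GROUPING).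
-/

-- every declaration of this summit lives under `Summit.ResolutionOfSingularities.ResolutionOfSingularities`
-- (summit = problem), which the duplicate-namespace linter flags; house convention (cf. the Target file).
set_option linter.dupNamespace false

noncomputable section

open MvPolynomial Finset CategoryTheory AlgebraicGeometry Opposite TopologicalSpace
open AlgebraicGeometry.Scheme.IdealSheafData (ofIdealTop vanishingIdeal)

namespace Summit.ResolutionOfSingularities.ResolutionOfSingularities.Theorems.PIDim4

open Literature.AlgebraicGeometry.Resolution
open Literature.AlgebraicGeometry.Resolution.AffinePointBlowup (P A γ coord Wtop)

namespace ChartDictionary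

/-! ## §1 Same chart: separated translations give disjoint chart-centres -/

section SameChart

variable {K : Type} [Field K] {S S'' S''' : Finset (Fin 4)} {j : Fin 4} {b b' : Fin 4 → K}
  {Θ Θ' : A 4 K →+* A 4 K}

/-- A point of the re-centred coordinate subspace `Spec Θ_b (V(x_{Λ''}))` contains `xᵢ − bᵢ` for every variable
`xᵢ` of `Λ''` (`Θ_b xᵢ = xᵢ + bᵢ`, constants fixed). -/
theorem X_sub_C_mem_of_specMap_mem_CΛ (hC : ∀ c : K, Θ (C c) = C c)
    (hs : ∀ k : Fin 4, Θ (X k.succ) = X k.succ + C (b k)) {y : P 4 K}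
    (hy : y ∈ AffineCoordBlowup.CΛ 4 K (insert 0 (Fin.succ '' (S'' : Set (Fin 4))))) {i : Fin 4} (hi : i ∈ S'') :
    (X i.succ - C (b i) : A 4 K) ∈ ((Spec.map (CommRingCat.ofHom Θ)) y).asIdeal := by
  rw [Spec.map_apply, PrimeSpectrum.comap_asIdeal, Ideal.mem_comap, CommRingCat.hom_ofHom, map_sub, hs i, hC,
    add_sub_cancel_right]
  exact (AffineCoordBlowup.mem_CΛ_iff' 4 K _ y).mp hy i.succ (succ_mem_centreVars hi)

/-- **SAME CHART, SEPARATED ⇒ DISJOINT (on `𝔸⁵`).** If some `i ∈ S'' ∩ S'''` has `bᵢ ≠ b'ᵢ`, the re-centred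
coordinate subspaces `Spec Θ_b (V(z, x_{S''}))` and `Spec Θ_{b'} (V(z, x_{S'''}))` are disjoint: a common point would
contain `xᵢ − bᵢ` and `xᵢ − b'ᵢ`, hence the unit `b'ᵢ − bᵢ`. (Any cleanings of `z`.) -/
theorem disjoint_image_CΛ_recenter_of_ne (hC : ∀ c : K, Θ (C c) = C c)
    (hs : ∀ k : Fin 4, Θ (X k.succ) = X k.succ + C (b k)) (hC' : ∀ c : K, Θ' (C c) = C c)
    (hs' : ∀ k : Fin 4, Θ' (X k.succ) = X k.succ + C (b' k)) {i : Fin 4} (hiS'' : i ∈ S'') (hiS''' : i ∈ S''')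
    (hne : b i ≠ b' i) :
    Disjoint ((Spec.map (CommRingCat.ofHom Θ)) ''
        (AffineCoordBlowup.CΛ 4 K (insert 0 (Fin.succ '' (S'' : Set (Fin 4)))) : Set (P 4 K)))
      ((Spec.map (CommRingCat.ofHom Θ')) ''
        (AffineCoordBlowup.CΛ 4 K (insert 0 (Fin.succ '' (S''' : Set (Fin 4)))) : Set (P 4 K))) := by
  rw [Set.disjoint_iff]
  rintro r ⟨⟨y, hy, rfl⟩, ⟨y', hy', hyy'⟩⟩
  have h1 := X_sub_C_mem_of_specMap_mem_CΛ hC hs hy hiS''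
  have h2 := X_sub_C_mem_of_specMap_mem_CΛ hC' hs' hy' hiS'''
  rw [hyy'] at h2
  have h3 : (C (b' i - b i) : A 4 K) ∈ ((Spec.map (CommRingCat.ofHom Θ)) y).asIdeal := by
    have h := Ideal.sub_mem _ h1 h2
    rwa [sub_sub_sub_cancel_left, ← C_sub] at h
  refine ((Spec.map (CommRingCat.ofHom Θ)) y).isPrime.ne_top ((Ideal.eq_top_iff_one _).mpr ?_)
  have h4 := Ideal.mul_mem_left _ (C (b' i - b i)⁻¹) h3
  rwa [← C_mul, inv_mul_cancel₀ (sub_ne_zero.mpr hne.symm), C_1] at h4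

variable {W : Scheme.{0}} {π : W ⟶ P 4 K}

/-- **SAME CHART, SEPARATED ⇒ DISJOINT (in the blow-up).** For any blowing up `π : W → 𝔸⁵_K` along `V(z, x_S)`,
`j ∈ S`, and two re-centrings `Θ_b`, `Θ_{b'}` of the `x_j`-chart: if some `i ∈ S'' ∩ S'''` has `bᵢ ≠ b'ᵢ`, the
chart-centres `T(j, b, S'')` and `T(j, b', S''')` are disjoint in `W`. -/
theorem disjoint_image_CΛ_chart_of_ne (hj : j ∈ S) (hC : ∀ c : K, Θ (C c) = C c)
    (hs : ∀ k : Fin 4, Θ (X k.succ) = X k.succ + C (b k)) (hC' : ∀ c : K, Θ' (C c) = C c)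
    (hs' : ∀ k : Fin 4, Θ' (X k.succ) = X k.succ + C (b' k))
    (hπ : IsBlowup π (AffineCoordBlowup.𝓘Λ 4 K (insert 0 (Fin.succ '' (S : Set (Fin 4))))))
    {i : Fin 4} (hiS'' : i ∈ S'') (hiS''' : i ∈ S''') (hne : b i ≠ b' i) :
    Disjoint ((Spec.map (CommRingCat.ofHom Θ) ≫ AffineCoordBlowup.chartImm hπ (succ_mem_centreVars hj)) ''
        (AffineCoordBlowup.CΛ 4 K (insert 0 (Fin.succ '' (S'' : Set (Fin 4)))) : Set (P 4 K)))
      ((Spec.map (CommRingCat.ofHom Θ') ≫ AffineCoordBlowup.chartImm hπ (succ_mem_centreVars hj)) ''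
        (AffineCoordBlowup.CΛ 4 K (insert 0 (Fin.succ '' (S''' : Set (Fin 4)))) : Set (P 4 K))) := by
  rw [Set.disjoint_iff]
  rintro w ⟨⟨y, hy, rfl⟩, ⟨y', hy', hyy'⟩⟩
  rw [Scheme.Hom.comp_apply, Scheme.Hom.comp_apply] at hyy'
  have hinj := (AffineCoordBlowup.chartImm hπ (succ_mem_centreVars hj)).isOpenEmbedding.injective hyy'
  exact (Set.disjoint_iff.mp (disjoint_image_CΛ_recenter_of_ne hC hs hC' hs' hiS'' hiS''' hne))
    ⟨⟨y, hy, rfl⟩, ⟨y', hy', hinj⟩⟩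

end SameChart

/-! ## §2 Across charts: a point on the strict transform of `x_j = 0` never meets the `x_j`-chart -/

section AcrossCharts

variable {K : Type} [Field K] {S S'' S''' : Finset (Fin 4)} {j j' : Fin 4} {b' : Fin 4 → K}
  {Θ Θ' : A 4 K →+* A 4 K} {W : Scheme.{0}} {π : W ⟶ P 4 K}

/-- **ACROSS CHARTS: `b'_j = 0` puts the chart-centre off the `x_j`-chart.** For `j ≠ j'` both in `S`, a
re-centring `Θ'` of the `x_{j'}`-chart with `Θ' x_j = x_j` (`b'_j = 0`) and a centre containing `x_j` (`j ∈ S'''`):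
`T(j', b', S''')` is disjoint from the image of the `x_j`-chart — the strict transform of `V(x_j)` contains it
(`strictTransformIdeal_hyperplane_comap_chartImm`) and misses the `x_j`-chart
(`strictTransformIdeal_hyperplane_self_comap_chartImm`). -/
theorem disjoint_image_CΛ_chart_range_of_eq_zero (hj : j ∈ S) (hj' : j' ∈ S) (hjj' : j ≠ j')
    (hΘ'j : Θ' (X j.succ) = X j.succ)
    (hπ : IsBlowup π (AffineCoordBlowup.𝓘Λ 4 K (insert 0 (Fin.succ '' (S : Set (Fin 4)))))) (hjS''' : j ∈ S''') :
    Disjoint ((Spec.map (CommRingCat.ofHom Θ') ≫ AffineCoordBlowup.chartImm hπ (succ_mem_centreVars hj')) ''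
        (AffineCoordBlowup.CΛ 4 K (insert 0 (Fin.succ '' (S''' : Set (Fin 4)))) : Set (P 4 K)))
      (Set.range (AffineCoordBlowup.chartImm hπ (succ_mem_centreVars hj))) := by
  haveI : IsProper π := hπ.isProper
  haveI : IsLocallyNoetherian W := LocallyOfFiniteType.isLocallyNoetherian π
  set H := strictTransformIdeal π (AffineCoordBlowup.𝓘Λ 4 K (insert 0 (Fin.succ '' (S : Set (Fin 4)))))
    (ofIdealTop (Ideal.span {coord 4 K j.succ})) with hH
  rw [Set.disjoint_iff]
  rintro w ⟨⟨y, hy, rfl⟩, ⟨r, hr⟩⟩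
  -- the point lies on the strict transform of `V(x_j)` …
  have hmem : (Spec.map (CommRingCat.ofHom Θ') ≫ AffineCoordBlowup.chartImm hπ (succ_mem_centreVars hj')) y ∈
      (H.support : Set W) := by
    have hX : (X j.succ : A 4 K) ∈ ((Spec.map (CommRingCat.ofHom Θ')) y).asIdeal := by
      rw [Spec.map_apply, PrimeSpectrum.comap_asIdeal, Ideal.mem_comap, CommRingCat.hom_ofHom, hΘ'j]
      exact (AffineCoordBlowup.mem_CΛ_iff' 4 K _ y).mp hy j.succ (succ_mem_centreVars hjS''')
    have h1 : (Spec.map (CommRingCat.ofHom Θ')) y ∈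
        ((H.comap (AffineCoordBlowup.chartImm hπ (succ_mem_centreVars hj'))).support : Set (P 4 K)) := by
      rw [hH, strictTransformIdeal_hyperplane_comap_chartImm hj' hjj' hπ, SetLike.mem_coe,
        show coord 4 K j.succ = (γ 4 K).symm (X j.succ) from rfl, Equimultiple.ofIdealTop_span_γ_symm_eq_shf,
        Literature.AlgebraicGeometry.Hironaka2017.SpecOrders.mem_support_shf_iff, Ideal.span_singleton_le_iff_mem]
      exact hX
    rw [Scheme.IdealSheafData.support_comap] at h1
    rw [Scheme.Hom.comp_apply]
    exact h1
  -- … which misses the `x_j`-chart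
  have h2 : r ∈ ((H.comap (AffineCoordBlowup.chartImm hπ (succ_mem_centreVars hj))).support : Set (P 4 K)) := by
    rw [Scheme.IdealSheafData.support_comap]
    show AffineCoordBlowup.chartImm hπ (succ_mem_centreVars hj) r ∈ (H.support : Set W)
    rw [hr]
    exact hmem
  rw [hH, strictTransformIdeal_hyperplane_self_comap_chartImm hj hπ, Scheme.IdealSheafData.support_top] at h2
  exact h2

/-- **ACROSS CHARTS, `b'_j = 0` ⇒ DISJOINT from every `x_j`-chart centre.** -/
theorem disjoint_image_CΛ_chart_of_ne_chart (hj : j ∈ S) (hj' : j' ∈ S) (hjj' : j ≠ j')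
    (hs' : ∀ k : Fin 4, Θ' (X k.succ) = X k.succ + C (b' k)) (hbj : b' j = 0)
    (hπ : IsBlowup π (AffineCoordBlowup.𝓘Λ 4 K (insert 0 (Fin.succ '' (S : Set (Fin 4)))))) (hjS''' : j ∈ S''') :
    Disjoint ((Spec.map (CommRingCat.ofHom Θ) ≫ AffineCoordBlowup.chartImm hπ (succ_mem_centreVars hj)) ''
        (AffineCoordBlowup.CΛ 4 K (insert 0 (Fin.succ '' (S'' : Set (Fin 4)))) : Set (P 4 K)))
      ((Spec.map (CommRingCat.ofHom Θ') ≫ AffineCoordBlowup.chartImm hπ (succ_mem_centreVars hj')) ''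
        (AffineCoordBlowup.CΛ 4 K (insert 0 (Fin.succ '' (S''' : Set (Fin 4)))) : Set (P 4 K))) := by
  have hΘ'j : Θ' (X j.succ) = X j.succ := by rw [hs' j, hbj, C_0, add_zero]
  refine Disjoint.symm ((disjoint_image_CΛ_chart_range_of_eq_zero hj hj' hjj' hΘ'j hπ hjS''').mono_right ?_)
  rintro _ ⟨y, -, rfl⟩
  rw [Scheme.Hom.comp_apply]
  exact ⟨_, rfl⟩

end AcrossCharts

/-! ## §3 The canonical description of a chart-centre: independent of the cleaning, with a membership test -/

section Canonical

variable {K : Type} [Field K] {S S'' : Finset (Fin 4)} {j : Fin 4} {b : Fin 4 → K} {Θ : A 4 K ≃ₐ[K] A 4 K}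
  {W : Scheme.{0}} {π : W ⟶ P 4 K}

/-- **THE CANONICAL DESCRIPTION OF A CHART-CENTRE.** Let `π : W → 𝔸⁵_K` be any blowing up along `V(z, x_S)`,
`j ∈ S`, `Θ` a re-centring automorphism of the `x_j`-chart (`Θ xᵢ = xᵢ + bᵢ`, any cleaning of `z`), and `J` an
ideal sheaf on `W` (the transformed ideal) reading `(z^p + G)·𝒪` on the re-centred chart, `p ≠ 0`, with `V(z, x_{S''})`
Hironaka-permissible for `z^p + G` (`p ≤ ord_{(x_{S''})} G`). Then
`T(j, b, S'') = φ_{j,b}(V(z, x_{S''})) = chartImm_j {r ∈ supp(J|_chart) : xᵢ − bᵢ ∈ 𝔭_r for all i ∈ S''}` —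
the order locus of `J` over the affine-linear subspace `{xᵢ = bᵢ, i ∈ S''}` of the RAW `x_j`-chart. In particular
the chart-centre does NOT depend on the cleaning of `z` (the `z`-coordinate is forced: `z^p ∈ 𝔭` by primality). -/
theorem image_CΛ_chart_eq_of_reading (hj : j ∈ S) (hs : ∀ k : Fin 4, Θ (X k.succ) = X k.succ + C (b k))
    (hπ : IsBlowup π (AffineCoordBlowup.𝓘Λ 4 K (insert 0 (Fin.succ '' (S : Set (Fin 4))))))
    {p : ℕ} (hp : p ≠ 0) {G : MvPolynomial (Fin 4) K} (hG : (p : ℕ∞) ≤ CentreBlowup.ordAlong S'' G)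
    (J : W.IdealSheafData)
    (hread : J.comap (Spec.map (CommRingCat.ofHom (Θ : A 4 K →+* A 4 K)) ≫
      AffineCoordBlowup.chartImm hπ (succ_mem_centreVars hj)) = hypSheaf p G) :
    (Spec.map (CommRingCat.ofHom (Θ : A 4 K →+* A 4 K)) ≫ AffineCoordBlowup.chartImm hπ (succ_mem_centreVars hj)) ''
        (AffineCoordBlowup.CΛ 4 K (insert 0 (Fin.succ '' (S'' : Set (Fin 4)))) : Set (P 4 K)) =
      AffineCoordBlowup.chartImm hπ (succ_mem_centreVars hj) ''
        {r : P 4 K | r ∈ (J.comap (AffineCoordBlowup.chartImm hπ (succ_mem_centreVars hj))).support ∧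
          ∀ i ∈ S'', (X i.succ - C (b i) : A 4 K) ∈ r.asIdeal} := by
  haveI : IsIso (CommRingCat.ofHom (Θ : A 4 K →+* A 4 K)) :=
    (inferInstance : IsIso Θ.toRingEquiv.toCommRingCatIso.hom)
  have hs' : ∀ k : Fin 4, (Θ : A 4 K →+* A 4 K) (X k.succ) = X k.succ + C (b k) := fun k => hs k
  have hC : ∀ c : K, (Θ : A 4 K →+* A 4 K) (C c) = C c := fun c => Θ.commutes c
  -- support on the raw chart = support of `(z^p + G)·𝒪` on the re-centred chart
  have hsupp : ∀ y : P 4 K,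
      (Spec.map (CommRingCat.ofHom (Θ : A 4 K →+* A 4 K))) y ∈
          (J.comap (AffineCoordBlowup.chartImm hπ (succ_mem_centreVars hj))).support ↔
        hyp p G ∈ y.asIdeal := by
    intro y
    have h1 : y ∈ ((J.comap (AffineCoordBlowup.chartImm hπ (succ_mem_centreVars hj))).comap
          (Spec.map (CommRingCat.ofHom (Θ : A 4 K →+* A 4 K)))).support ↔
        (Spec.map (CommRingCat.ofHom (Θ : A 4 K →+* A 4 K))) y ∈
          (J.comap (AffineCoordBlowup.chartImm hπ (succ_mem_centreVars hj))).support := by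
      rw [Scheme.IdealSheafData.support_comap]; rfl
    rw [← h1, ← Scheme.IdealSheafData.comap_comp, hread, Equimultiple.hypSheaf_eq_shf,
      Literature.AlgebraicGeometry.Hironaka2017.SpecOrders.mem_support_shf_iff, Ideal.span_singleton_le_iff_mem]
  -- `G(x) ∈ (xᵢ : i ∈ S'')` since `p ≤ ord_{(x_{S''})} G` and `p ≠ 0`
  have hGmem : ∀ y : P 4 K, (∀ i ∈ S'', (X i.succ : A 4 K) ∈ y.asIdeal) → rename Fin.succ G ∈ y.asIdeal := by
    intro y hy
    have h1 : G ∈ Ideal.span (X '' (S'' : Set (Fin 4)) : Set (MvPolynomial (Fin 4) K)) :=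
      Ideal.pow_le_self hp (mem_pow_span_X_of_le_ordAlong p S'' G hG)
    have h2 : rename Fin.succ G ∈ (Ideal.span (X '' (S'' : Set (Fin 4)) : Set (MvPolynomial (Fin 4) K))).map
        (rename Fin.succ : MvPolynomial (Fin 4) K →ₐ[K] A 4 K) := Ideal.mem_map_of_mem _ h1
    rw [Ideal.map_span] at h2
    refine (Ideal.span_le.mpr ?_) h2
    rintro _ ⟨_, ⟨i, hi, rfl⟩, rfl⟩
    rw [SetLike.mem_coe, show ((rename Fin.succ : MvPolynomial (Fin 4) K →ₐ[K] A 4 K) (X i) : A 4 K) = X i.succ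
      from rename_X _ _]
    exact hy i hi
  ext w
  constructor
  · rintro ⟨y, hy, rfl⟩
    refine ⟨Spec.map (CommRingCat.ofHom (Θ : A 4 K →+* A 4 K)) y, ⟨?_, fun i hi =>
      X_sub_C_mem_of_specMap_mem_CΛ hC hs' hy hi⟩, by rw [Scheme.Hom.comp_apply]⟩
    rw [hsupp]
    have hord := le_idealOrder_hypSheaf_of_mem_CΛ p S'' G hG hy
    have h1 : y ∈ (hypSheaf p G).support :=
      (one_le_idealOrder_iff _ y).mp (le_trans (by exact_mod_cast Nat.one_le_iff_ne_zero.mpr hp) hord)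
    rwa [Equimultiple.hypSheaf_eq_shf, Literature.AlgebraicGeometry.Hironaka2017.SpecOrders.mem_support_shf_iff,
      Ideal.span_singleton_le_iff_mem] at h1
  · rintro ⟨r, ⟨hr, hX⟩, rfl⟩
    obtain ⟨y, rfl⟩ := (Spec.map (CommRingCat.ofHom (Θ : A 4 K →+* A 4 K))).surjective r
    refine ⟨y, ?_, by rw [Scheme.Hom.comp_apply]⟩
    have hXy : ∀ i ∈ S'', (X i.succ : A 4 K) ∈ y.asIdeal := by
      intro i hi
      have h := hX i hi
      rwa [Spec.map_apply, PrimeSpectrum.comap_asIdeal, Ideal.mem_comap, CommRingCat.hom_ofHom, map_sub, hs' i, hC,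
        add_sub_cancel_right] at h
    rw [SetLike.mem_coe, AffineCoordBlowup.mem_CΛ_iff']
    rintro m (rfl | ⟨i, hi, rfl⟩)
    · -- `z^p = (z^p + G) − G ∈ 𝔭`, hence `z ∈ 𝔭`
      have hhyp : hyp p G ∈ y.asIdeal := (hsupp y).mp hr
      have hzp : (X 0 : A 4 K) ^ p ∈ y.asIdeal := by
        have h := y.asIdeal.sub_mem hhyp (hGmem y hXy)
        rwa [hyp, add_sub_cancel_right] at h
      exact y.isPrime.mem_of_pow_mem p hzp
    · exact hXy i hi

/-- **MEMBERSHIP TEST.** In the situation of `image_CΛ_chart_eq_of_reading`, a point `chartImm_j r` of the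
`x_j`-chart lies in the chart-centre `T(j, b, S'')` iff `r ∈ supp(J|_chart)` and `xᵢ − bᵢ ∈ 𝔭_r` for all `i ∈ S''`. -/
theorem chartImm_mem_image_CΛ_chart_iff (hj : j ∈ S) (hs : ∀ k : Fin 4, Θ (X k.succ) = X k.succ + C (b k))
    (hπ : IsBlowup π (AffineCoordBlowup.𝓘Λ 4 K (insert 0 (Fin.succ '' (S : Set (Fin 4))))))
    {p : ℕ} (hp : p ≠ 0) {G : MvPolynomial (Fin 4) K} (hG : (p : ℕ∞) ≤ CentreBlowup.ordAlong S'' G)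
    (J : W.IdealSheafData)
    (hread : J.comap (Spec.map (CommRingCat.ofHom (Θ : A 4 K →+* A 4 K)) ≫
      AffineCoordBlowup.chartImm hπ (succ_mem_centreVars hj)) = hypSheaf p G) (r : P 4 K) :
    AffineCoordBlowup.chartImm hπ (succ_mem_centreVars hj) r ∈
        (Spec.map (CommRingCat.ofHom (Θ : A 4 K →+* A 4 K)) ≫ AffineCoordBlowup.chartImm hπ (succ_mem_centreVars hj)) ''
          (AffineCoordBlowup.CΛ 4 K (insert 0 (Fin.succ '' (S'' : Set (Fin 4)))) : Set (P 4 K)) ↔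
      r ∈ (J.comap (AffineCoordBlowup.chartImm hπ (succ_mem_centreVars hj))).support ∧
        ∀ i ∈ S'', (X i.succ - C (b i) : A 4 K) ∈ r.asIdeal := by
  rw [image_CΛ_chart_eq_of_reading hj hs hπ hp hG J hread,
    (AffineCoordBlowup.chartImm hπ (succ_mem_centreVars hj)).isOpenEmbedding.injective.mem_set_image]
  rfl

/-- **The chart-centre does not depend on the cleaning**: two re-centrings with the same translation `b` whose
charts read `(z^p + G₁)·𝒪`, `(z^p + G₂)·𝒪` with `V(z, x_{S''})` permissible for both give the same
`T(j, b, S'')`. -/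
theorem image_CΛ_chart_eq_of_readings (hj : j ∈ S) {Θ₁ Θ₂ : A 4 K ≃ₐ[K] A 4 K}
    (hs₁ : ∀ k : Fin 4, Θ₁ (X k.succ) = X k.succ + C (b k)) (hs₂ : ∀ k : Fin 4, Θ₂ (X k.succ) = X k.succ + C (b k))
    (hπ : IsBlowup π (AffineCoordBlowup.𝓘Λ 4 K (insert 0 (Fin.succ '' (S : Set (Fin 4))))))
    {p : ℕ} (hp : p ≠ 0) {G₁ G₂ : MvPolynomial (Fin 4) K} (hG₁ : (p : ℕ∞) ≤ CentreBlowup.ordAlong S'' G₁)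
    (hG₂ : (p : ℕ∞) ≤ CentreBlowup.ordAlong S'' G₂) (J : W.IdealSheafData)
    (hread₁ : J.comap (Spec.map (CommRingCat.ofHom (Θ₁ : A 4 K →+* A 4 K)) ≫
      AffineCoordBlowup.chartImm hπ (succ_mem_centreVars hj)) = hypSheaf p G₁)
    (hread₂ : J.comap (Spec.map (CommRingCat.ofHom (Θ₂ : A 4 K →+* A 4 K)) ≫
      AffineCoordBlowup.chartImm hπ (succ_mem_centreVars hj)) = hypSheaf p G₂) :
    (Spec.map (CommRingCat.ofHom (Θ₁ : A 4 K →+* A 4 K)) ≫ AffineCoordBlowup.chartImm hπ (succ_mem_centreVars hj)) ''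
        (AffineCoordBlowup.CΛ 4 K (insert 0 (Fin.succ '' (S'' : Set (Fin 4)))) : Set (P 4 K)) =
      (Spec.map (CommRingCat.ofHom (Θ₂ : A 4 K →+* A 4 K)) ≫ AffineCoordBlowup.chartImm hπ (succ_mem_centreVars hj)) ''
        (AffineCoordBlowup.CΛ 4 K (insert 0 (Fin.succ '' (S'' : Set (Fin 4)))) : Set (P 4 K)) := by
  rw [image_CΛ_chart_eq_of_reading hj hs₁ hπ hp hG₁ J hread₁, image_CΛ_chart_eq_of_reading hj hs₂ hπ hp hG₂ J hread₂]

end Canonical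

/-! ## §4 The membership test at a rational point of the model (typ-3 g3's `mem_image_CΛ_chart_of_agree`) -/

section Agree

variable {K : Type} [Field K] {p : ℕ} {S S'' : Finset (Fin 4)} {j : Fin 4} {b : Fin 4 → K}
  {Θ : A 4 K ≃ₐ[K] A 4 K} {W : Scheme.{0}} {π : W ⟶ P 4 K}

/-- **A rational point of the model hypersurface whose `x`-coordinates agree with `b` on `S''` lies in the
chart-centre `T(j, b, S'')`.** `π` any blowing up of `𝔸⁵_K` along `V(z, x_S)`, `s` with `p ≤ ord_{(x_S)} s.F`
(`p ≠ 0`), `Θ` a re-centring of the `x_j`-chart at `b` whose chart reads the controlled transform as `(z^p + G)·𝒪` with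
`V(z, x_{S''})` permissible for `z^p + G` (typ-2's `controlledTransform_chart_eq_step`, `G = (step p S j b s).F`); then
for a rational point `x = (a', b')` of the raw `x_j`-chart ON the transform (`a'^p + F'_j(b') = 0`) with `b'ᵢ = bᵢ`
for `i ∈ S''`: `chartImm_j x ∈ T(j, b, S'')`. -/
theorem mem_image_CΛ_chart_of_agree (hj : j ∈ S) (hs : ∀ k : Fin 4, Θ (X k.succ) = X k.succ + C (b k))
    (hπ : IsBlowup π (AffineCoordBlowup.𝓘Λ 4 K (insert 0 (Fin.succ '' (S : Set (Fin 4)))))) (hp : p ≠ 0)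
    (s : State K) (hperm : (p : ℕ∞) ≤ CentreBlowup.ordAlong S s.F) {G : MvPolynomial (Fin 4) K}
    (hG : (p : ℕ∞) ≤ CentreBlowup.ordAlong S'' G)
    (hread : (controlledTransform π (AffineCoordBlowup.𝓘Λ 4 K (insert 0 (Fin.succ '' (S : Set (Fin 4)))))
        (hypSheaf p s.F) p).comap
        (Spec.map (CommRingCat.ofHom (Θ : A 4 K →+* A 4 K)) ≫ AffineCoordBlowup.chartImm hπ (succ_mem_centreVars hj)) =
      hypSheaf p G)
    {x : P 4 K} {a' : K} {b' : Fin 4 → K}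
    (hx : x.asIdeal = MvPolynomial.vanishingIdeal K {(Fin.cons a' b' : Fin (4 + 1) → K)})
    (hab : a' ^ p + eval b' (CentreBlowup.chartTransform p S j s.F) = 0) (hagree : ∀ i ∈ S'', b' i = b i) :
    AffineCoordBlowup.chartImm hπ (succ_mem_centreVars hj) x ∈
      (Spec.map (CommRingCat.ofHom (Θ : A 4 K →+* A 4 K)) ≫ AffineCoordBlowup.chartImm hπ (succ_mem_centreVars hj)) ''
        (AffineCoordBlowup.CΛ 4 K (insert 0 (Fin.succ '' (S'' : Set (Fin 4)))) : Set (P 4 K)) := by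
  rw [chartImm_mem_image_CΛ_chart_iff hj hs hπ hp hG _ hread]
  refine ⟨?_, fun i hi => ?_⟩
  swap
  · -- `xᵢ − bᵢ` vanishes at `(a', b')` since `b'ᵢ = bᵢ`
    rw [hx, MvPolynomial.mem_vanishingIdeal_singleton_iff, map_sub, aeval_X, aeval_C, Fin.cons_succ, sub_eq_zero]
    exact hagree i hi
  -- the point lies on the transform: `(z^p + F'_j)(a', b') = 0`
  rw [controlledTransform_comap_chartImm p hj s.F hperm hπ, Equimultiple.hypSheaf_eq_shf,
    Literature.AlgebraicGeometry.Hironaka2017.SpecOrders.mem_support_shf_iff, Ideal.span_singleton_le_iff_mem, hx,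
    MvPolynomial.mem_vanishingIdeal_singleton_iff, hyp, map_add, map_pow, aeval_X, Fin.cons_zero, aeval_rename]
  have hcomp : ((Fin.cons a' b' : Fin (4 + 1) → K) ∘ Fin.succ) = b' :=
    _root_.funext fun i => by rw [Function.comp_apply, Fin.cons_succ]
  rw [hcomp]
  exact hab

end Agree

end ChartDictionary

end Summit.ResolutionOfSingularities.ResolutionOfSingularities.Theorems.PIDim4

end
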